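import Literature.MathematicalPhysics.StatisticalMechanics.DiluteHardSphereGasProofs
import Literature.Analysis.FunctionSpaces.PoissonSuperpositionProofs
import Literature.Analysis.FunctionSpaces.PoissonPointProcessUniqueness
import HarnessLib

/-!
# `StressStrongMixing` · line `birth`, stub `stub_lowDensityGibbsUniqueness3` (infrastructure 1/3):
# raising the activity of a finite hard-sphere Poisson gas by an independent sparse cloud

Support file for the crux item stmt-AtomisticToContinuum-9584 (`StressStrongMixing`, route
`MourreKoopmanCharges` of `AtomisticToContinuum/HydrodynamicLimit`), serving the registered stub
`stub_lowDensityGibbsUniqueness3` of `Cruxes/StressStrongMixing/Lines/birth.lean` (two translation-invariant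
unit-diameter hard-sphere DLR states in `ℝ³` with the same small density coincide).  The missing ingredient is
the injectivity of the density in the activity at small activity, which we obtain from a LIPSCHITZ bound on the
activity-dependence of the vacancy probability of the exclusion ball.  This file supplies the finite-volume
mechanism, for two finite atomless intensities `m₁` (the added cloud) and `m₂` on the phase space
`Phase = ℝ³ × ℝ³` of the tree's `HardSphere` prelude:

* `poissonLaw_add_eq_map_prod` — `Poisson(m₁ + m₂)` is the superposition of independent `Poisson(m₁)` and
  `Poisson(m₂)` samples (Kingman's Superposition Theorem and Rényi uniqueness, both proved in the tree);
* `measure_hardCore_void_add_eq_lintegral` — CONDITIONING ON THE CLOUD: the hard-core void probability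
  `Z_{m₁+m₂}(F) = P{hard core, no point in F}` is the `Poisson(m₁)`-average over clouds `D` of
  `1[D hard core, D avoids F] · Z_{m₂}(F ∪ N(D))`, `N(D) = ⋃_{x ∈ D} B°_σ(x) × ℝ³` the region forbidden by `D`
  (Fubini over the superposition; the two samples are a.s. disjoint);
* `lintegral_cloudWeight_mul_count_le` — MECKE BOUND: the cloud weight `a(D) = 1[…] Z_{m₂}(F ∪ N(D))` is
  antitone under insertion of a point, so `∫ a(D) N_D(U) dPoisson(m₁) ≤ m₁(U) ∫ a dPoisson(m₁)` (the tilted cloud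
  is stochastically thinner than the free one);
* `hsLocalSpec_empty_apply_eq_mul` — the free finite-volume Gibbs probability as a ratio of reference-law
  probabilities (the free boundary condition glues nothing);
* `abs_toReal_div_sub_toReal_le` — an abstract perturbation lemma for ratios `∫ a ρ / ∫ a`.

References: J. F. C. Kingman, *Poisson Processes* (1993), §2.2; G. Last, M. Penrose, *Lectures on the Poisson
Process* (2017), Thm 4.1 (Mecke equation); M. Michelen, W. Perkins, arXiv:2109.01094, §3 (integral identities).
-/

noncomputable section

open MeasureTheory ProbabilityTheory Set Filter Function
open scoped ENNReal NNReal Topology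

namespace Summit.AtomisticToContinuum.HydrodynamicLimit.Theorems.MourreKoopmanChargesStressStrongMixing

open Literature.Analysis.FunctionSpaces
open Literature.MathematicalPhysics.KineticTheory
open Literature.MathematicalPhysics.StatisticalMechanics
open Literature.MathematicalPhysics.StatisticalMechanics.HardSphere (Pos Phase window hardCoreSet glue poissonLaw
  IsHardCore)

/-! ## Superposition of Poisson laws with added intensities -/

/-- **Superposition for a sum of finite atomless intensities**: `Poisson(m₁ + m₂)` is the image of
`Poisson(m₁) ⊗ Poisson(m₂)` under `(D, ω) ↦ D ∪ ω`. -/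
theorem poissonLaw_add_eq_map_prod (m₁ m₂ : Measure Phase) [IsFiniteMeasure m₁] [IsFiniteMeasure m₂]
    (h₁ : ∀ x, m₁ {x} = 0) (h₂ : ∀ x, m₂ {x} = 0) :
    poissonLaw (m₁ + m₂) = ((poissonLaw m₁).prod (poissonLaw m₂)).map
      (fun p : PointConfig Phase × PointConfig Phase => p.1 ∪ p.2) := by
  have hP₁ := HardSphere.isPoissonPointProcess_poissonLaw m₁ h₁
  have hP₂ := HardSphere.isPoissonPointProcess_poissonLaw m₂ h₂
  have h12 : ∀ x, (m₁ + m₂) {x} = 0 := fun x => by simp [h₁ x, h₂ x]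
  have hP := HardSphere.isPoissonPointProcess_poissonLaw (m₁ + m₂) h12
  exact IsPoissonPointProcess.unique_holds hP (IsPoissonPointProcess.superposition_holds hP₁ hP₂)

/-! ## Configuration algebra -/

/-- A superposition has no point in `s` iff neither part has. -/
theorem count_sup_eq_zero_iff {c d : PointConfig Phase} {s : Set Phase} :
    (c ∪ d).count s = 0 ↔ c.count s = 0 ∧ d.count s = 0 := by
  simp only [count_eq_zero_iff', PointConfig.mem_union]
  exact ⟨fun h => ⟨fun x hx => h x (Or.inl hx), fun x hx => h x (Or.inr hx)⟩,
    fun h x hx => hx.elim (h.1 x) (h.2 x)⟩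

/-- Every configuration has no point in the empty set. -/
theorem count_emptyset (c : PointConfig Phase) : c.count (∅ : Set Phase) = 0 := by
  simp [PointConfig.count]

/-- The hard-core void event of the empty forbidden region is the hard-core event. -/
theorem hardCoreSet_inter_count_empty (σ : ℝ) :
    hardCoreSet σ ∩ {ζ : PointConfig Phase | ζ.count (∅ : Set Phase) = 0} = hardCoreSet σ := by
  ext ζ
  simp [count_emptyset]

/-- The region forbidden by a configuration grows under insertion of points. -/
theorem biUnion_window_ball_mono (σ : ℝ) {c d : PointConfig Phase} (h : (c : Set Phase) ⊆ (d : Set Phase)) :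
    (⋃ x ∈ (c : Set Phase), window (Metric.ball x.1 σ)) ⊆ ⋃ x ∈ (d : Set Phase), window (Metric.ball x.1 σ) :=
  biUnion_subset_biUnion_left h

/-- Void events are antitone in the tested set. -/
theorem setOf_count_eq_zero_anti {s t : Set Phase} (h : s ⊆ t) :
    {ζ : PointConfig Phase | ζ.count t = 0} ⊆ {ζ | ζ.count s = 0} := fun ζ hζ => by
  have hζ' : ζ.count t = 0 := hζ
  change ζ.count s = 0
  rw [count_eq_zero_iff'] at hζ' ⊢
  exact fun x hx hxs => hζ' x hx (h hxs)

/-! ## Conditioning on the cloud -/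

section Cloud

variable {m₁ m₂ : Measure Phase} [IsFiniteMeasure m₁] [IsFiniteMeasure m₂]

/-- **Conditioning on the cloud.** For finite atomless intensities `m₁, m₂`, a measurable forbidden region `F`
and any diameter `σ`,
`Poisson(m₁+m₂){hard core, no point in F} = ∫ 1[D hard core, D avoids F] · Poisson(m₂){hard core, no point in
F ∪ N(D)} dPoisson(m₁)(D)`, `N(D) = ⋃_{x ∈ D} B°_σ(x) × ℝ³`: the superposition `D ∪ ω` is hard core iff both
parts are and `ω` avoids the region forbidden by `D` (the parts being a.s. disjoint). -/
theorem measure_hardCore_void_add_eq_lintegral (h₁ : ∀ x, m₁ {x} = 0) (h₂ : ∀ x, m₂ {x} = 0) (σ : ℝ)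
    {F : Set Phase} (hF : MeasurableSet F) :
    poissonLaw (m₁ + m₂) (hardCoreSet σ ∩ {ζ : PointConfig Phase | ζ.count F = 0}) =
      ∫⁻ D, (hardCoreSet σ ∩ {ζ : PointConfig Phase | ζ.count F = 0}).indicator (1 : PointConfig Phase → ℝ≥0∞) D *
        poissonLaw m₂ (hardCoreSet σ ∩ {ζ : PointConfig Phase |
          ζ.count (F ∪ ⋃ x ∈ (D : Set Phase), window (Metric.ball x.1 σ)) = 0}) ∂(poissonLaw m₁) := by
  classical
  have hP₁ := HardSphere.isPoissonPointProcess_poissonLaw m₁ h₁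
  have hP₂ := HardSphere.isPoissonPointProcess_poissonLaw m₂ h₂
  haveI := hP₁.isProbabilityMeasure
  haveI := hP₂.isProbabilityMeasure
  have hE : MeasurableSet (hardCoreSet σ ∩ {ζ : PointConfig Phase | ζ.count F = 0}) :=
    measurableSet_hardCore_void σ hF
  have hu : Measurable fun p : PointConfig Phase × PointConfig Phase => p.1 ∪ p.2 :=
    PointConfig.measurable_union'
  rw [poissonLaw_add_eq_map_prod m₁ m₂ h₁ h₂, Measure.map_apply hu hE, Measure.prod_apply (hu hE)]
  refine lintegral_congr fun D => ?_
  set N : Set Phase := ⋃ x ∈ (D : Set Phase), window (Metric.ball x.1 σ) with hN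
  set E' : Set (PointConfig Phase) := hardCoreSet σ ∩ {ζ : PointConfig Phase | ζ.count (F ∪ N) = 0} with hE'
  -- a.s. the second sample shares no point with `D`
  have hnull : ∀ᵐ ω : PointConfig Phase ∂(poissonLaw m₂), Disjoint (D : Set Phase) (ω : Set Phase) := by
    have h : ∀ᵐ ω : PointConfig Phase ∂(poissonLaw m₂), ∀ x ∈ (D : Set Phase), x ∉ ω := by
      rw [ae_ball_iff D.countable_carrier]
      intro x _
      rw [ae_iff]
      simpa only [not_not] using hP₂.measure_setOf_mem_eq_zero (measurableSet_singleton x)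
    filter_upwards [h] with ω hω
    exact Set.disjoint_left.2 fun x hxD hxω => hω x hxD hxω
  have hset : (Prod.mk D ⁻¹' ((fun p : PointConfig Phase × PointConfig Phase => p.1 ∪ p.2) ⁻¹'
      (hardCoreSet σ ∩ {ζ : PointConfig Phase | ζ.count F = 0}))) =ᵐ[poissonLaw m₂]
      (if IsHardCore σ D ∧ D.count F = 0 then E' else ∅ : Set (PointConfig Phase)) := by
    filter_upwards [hnull] with ω hω
    refine propext ?_
    change (D ∪ ω ∈ hardCoreSet σ ∧ (D ∪ ω).count F = 0) ↔
      ω ∈ (if IsHardCore σ D ∧ D.count F = 0 then E' else ∅ : Set (PointConfig Phase))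
    rw [HardSphere.mem_hardCoreSet, isHardCore_union_iff_count_eq_zero hω, count_sup_eq_zero_iff]
    by_cases h : IsHardCore σ D ∧ D.count F = 0
    · rw [if_pos h]
      simp only [hE', mem_inter_iff, HardSphere.mem_hardCoreSet, mem_setOf_eq, count_union_eq_zero_iff, h,
        true_and]
      tauto
    · rw [if_neg h]
      simp only [mem_empty_iff_false, iff_false]
      rintro ⟨⟨hD, -, -⟩, hDF, -⟩
      exact h ⟨hD, hDF⟩
  rw [measure_congr hset]
  by_cases h : IsHardCore σ D ∧ D.count F = 0
  · rw [if_pos h, indicator_of_mem (show D ∈ hardCoreSet σ ∩ {ζ : PointConfig Phase | ζ.count F = 0} from h),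
      Pi.one_apply, one_mul]
  · rw [if_neg h, measure_empty,
      indicator_of_notMem (show D ∉ hardCoreSet σ ∩ {ζ : PointConfig Phase | ζ.count F = 0} from h), zero_mul]

/-- The cloud weight `a(D) = 1[D hard core, D avoids F] · Z_{m₂}(F ∪ N(D))` is measurable in the cloud. -/
theorem measurable_cloudWeight (σ : ℝ) {F : Set Phase} (hF : MeasurableSet F) (P : Measure (PointConfig Phase))
    [SFinite P] :
    Measurable fun D : PointConfig Phase =>
      (hardCoreSet σ ∩ {ζ : PointConfig Phase | ζ.count F = 0}).indicator (1 : PointConfig Phase → ℝ≥0∞) D *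
        P (hardCoreSet σ ∩ {ζ : PointConfig Phase |
          ζ.count (F ∪ ⋃ x ∈ (D : Set Phase), window (Metric.ball x.1 σ)) = 0}) :=
  (measurable_one.indicator (measurableSet_hardCore_void σ hF)).mul (measurable_measure_hardCore_void_biUnion σ hF P)

/-- **The cloud weight is antitone under insertion of a point**: inserting a point can only destroy the hard
core of the cloud, add a point in `F`, and enlarge the forbidden region. -/
theorem cloudWeight_insert_le (σ : ℝ) (F : Set Phase) (P : Measure (PointConfig Phase)) (D : PointConfig Phase)
    (a : Phase) :
    (hardCoreSet σ ∩ {ζ : PointConfig Phase | ζ.count F = 0}).indicator (1 : PointConfig Phase → ℝ≥0∞)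
          (D ∪ PointConfig.ofFn fun _ : Fin 1 => a) *
        P (hardCoreSet σ ∩ {ζ : PointConfig Phase | ζ.count
          (F ∪ ⋃ x ∈ ((D ∪ PointConfig.ofFn fun _ : Fin 1 => a : PointConfig Phase) : Set Phase),
            window (Metric.ball x.1 σ)) = 0}) ≤
      (hardCoreSet σ ∩ {ζ : PointConfig Phase | ζ.count F = 0}).indicator (1 : PointConfig Phase → ℝ≥0∞) D *
        P (hardCoreSet σ ∩ {ζ : PointConfig Phase |
          ζ.count (F ∪ ⋃ x ∈ (D : Set Phase), window (Metric.ball x.1 σ)) = 0}) := by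
  set D' : PointConfig Phase := D ∪ PointConfig.ofFn fun _ : Fin 1 => a with hD'
  have hsub : (D : Set Phase) ⊆ (D' : Set Phase) := fun x hx => (PointConfig.mem_union).2 (Or.inl hx)
  refine mul_le_mul' ?_ (measure_mono (inter_subset_inter_right _ (setOf_count_eq_zero_anti
    (union_subset_union_right F (biUnion_window_ball_mono σ hsub)))))
  by_cases hD : D' ∈ hardCoreSet σ ∩ {ζ : PointConfig Phase | ζ.count F = 0}
  · have hD0 : D ∈ hardCoreSet σ ∩ {ζ : PointConfig Phase | ζ.count F = 0} :=
      ⟨HardSphere.IsHardCore.of_subset hD.1 hsub, setOf_count_eq_zero_anti (subset_refl F)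
        (show D ∈ {ζ : PointConfig Phase | ζ.count F = 0} from by
          have h2 : D'.count F = 0 := hD.2
          change D.count F = 0
          rw [count_eq_zero_iff'] at h2 ⊢
          exact fun x hx => h2 x (hsub hx))⟩
    rw [indicator_of_mem hD, indicator_of_mem hD0, Pi.one_apply, Pi.one_apply]
  · rw [indicator_of_notMem hD]
    exact bot_le

/-- **Mecke bound for the tilted cloud**: for a measurable `U`,
`∫ a(D) N_D(U) dPoisson(m₁)(D) ≤ m₁(U) · ∫ a dPoisson(m₁)` — by Mecke's equation the left side is
`∫_U ∫ a(D ∪ {x}) dPoisson(m₁) m₁(dx)`, and `a(D ∪ {x}) ≤ a(D)`. -/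
theorem lintegral_cloudWeight_mul_count_le (h₁ : ∀ x, m₁ {x} = 0) (σ : ℝ) {F : Set Phase} (hF : MeasurableSet F)
    (P : Measure (PointConfig Phase)) [SFinite P] {U : Set Phase} (hU : MeasurableSet U) :
    ∫⁻ D, (hardCoreSet σ ∩ {ζ : PointConfig Phase | ζ.count F = 0}).indicator (1 : PointConfig Phase → ℝ≥0∞) D *
        P (hardCoreSet σ ∩ {ζ : PointConfig Phase |
          ζ.count (F ∪ ⋃ x ∈ (D : Set Phase), window (Metric.ball x.1 σ)) = 0}) *
        ((D.count U : ℕ∞) : ℝ≥0∞) ∂(poissonLaw m₁) ≤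
      m₁ U * ∫⁻ D, (hardCoreSet σ ∩ {ζ : PointConfig Phase | ζ.count F = 0}).indicator
          (1 : PointConfig Phase → ℝ≥0∞) D *
        P (hardCoreSet σ ∩ {ζ : PointConfig Phase |
          ζ.count (F ∪ ⋃ x ∈ (D : Set Phase), window (Metric.ball x.1 σ)) = 0}) ∂(poissonLaw m₁) := by
  have hP₁ := HardSphere.isPoissonPointProcess_poissonLaw m₁ h₁
  haveI := hP₁.isProbabilityMeasure
  set w : PointConfig Phase → ℝ≥0∞ := fun D =>
    (hardCoreSet σ ∩ {ζ : PointConfig Phase | ζ.count F = 0}).indicator (1 : PointConfig Phase → ℝ≥0∞) D *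
      P (hardCoreSet σ ∩ {ζ : PointConfig Phase |
        ζ.count (F ∪ ⋃ x ∈ (D : Set Phase), window (Metric.ball x.1 σ)) = 0}) with hw
  have hwm : Measurable w := measurable_cloudWeight σ hF P
  set f : PointConfig Phase × Phase → ℝ≥0∞ := fun p => w p.1 * U.indicator 1 p.2 with hf
  have hfm : Measurable f := (hwm.comp measurable_fst).mul ((measurable_one.indicator hU).comp measurable_snd)
  have hL : ∀ D : PointConfig Phase, w D * ((D.count U : ℕ∞) : ℝ≥0∞) = ∑' a : (D : Set Phase), f (D, a) := fun D => by
    simp only [hf]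
    rw [ENNReal.tsum_mul_left, tsum_coe_indicator_one]
  change ∫⁻ D, w D * ((D.count U : ℕ∞) : ℝ≥0∞) ∂(poissonLaw m₁) ≤ m₁ U * ∫⁻ D, w D ∂(poissonLaw m₁)
  simp_rw [hL]
  rw [hP₁.lintegral_tsum_eq_lintegral_lintegral_insert hfm]
  calc ∫⁻ a, ∫⁻ D, f (D ∪ PointConfig.ofFn (fun _ : Fin 1 => a), a) ∂(poissonLaw m₁) ∂m₁
      ≤ ∫⁻ a, ∫⁻ D, w D * U.indicator 1 a ∂(poissonLaw m₁) ∂m₁ := by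
        refine lintegral_mono fun a => lintegral_mono fun D => ?_
        simp only [hf]
        exact mul_le_mul' (cloudWeight_insert_le σ F P D a) le_rfl
    _ = ∫⁻ a, U.indicator 1 a * ∫⁻ D, w D ∂(poissonLaw m₁) ∂m₁ := by
        refine lintegral_congr fun a => ?_
        rw [lintegral_mul_const _ hwm, mul_comm]
    _ = m₁ U * ∫⁻ D, w D ∂(poissonLaw m₁) := by
        rw [lintegral_mul_const _ (measurable_one.indicator hU), lintegral_indicator_one hU]

/-- **Registered helper stub (infrastructure 1/3 of `stub_lowDensityGibbsUniqueness3`)**: the cloud-conditioning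
formula `measure_hardCore_void_add_eq_lintegral` in closed form. -/
theorem lowDensityGibbsUniqueness3_cloudConditioning : ∀ (m₁ m₂ : Measure Phase), IsFiniteMeasure m₁ → IsFiniteMeasure m₂ → (∀ x, m₁ {x} = 0) → (∀ x, m₂ {x} = 0) → ∀ (σ : ℝ) (F : Set Phase), MeasurableSet F → poissonLaw (m₁ + m₂) (hardCoreSet σ ∩ {ζ : PointConfig Phase | ζ.count F = 0}) = ∫⁻ D, (hardCoreSet σ ∩ {ζ : PointConfig Phase | ζ.count F = 0}).indicator (1 : PointConfig Phase → ℝ≥0∞) D * poissonLaw m₂ (hardCoreSet σ ∩ {ζ : PointConfig Phase | ζ.count (F ∪ ⋃ x ∈ (D : Set Phase), window (Metric.ball x.1 σ)) = 0}) ∂(poissonLaw m₁) := by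
  intro m₁ m₂ hf₁ hf₂ h₁ h₂ σ F hF
  haveI := hf₁
  haveI := hf₂
  exact measure_hardCore_void_add_eq_lintegral h₁ h₂ σ hF

end Cloud

/-! ## The free finite-volume Gibbs probability as a ratio -/

/-- **The free finite-volume distribution in terms of the reference law**: for a locally finite atomless
intensity `ν`, a measurable region `Λ` and a measurable event `A`,
`γ_Λ(∅)(A) = P_Λ(hard core)⁻¹ · P_Λ(A ∩ hard core)`, `P_Λ = Poisson(ν|_{Λ × ℝ³})` (the free boundary condition
glues nothing, and `P_Λ`-a.s. the sample lives in the window). -/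
theorem hsLocalSpec_empty_apply_eq_mul (ν : Measure Phase) [IsLocallyFiniteMeasure ν] (h0 : ∀ x, ν {x} = 0)
    (σ : ℝ) {Λ : Set Pos} (hΛ : MeasurableSet Λ) {A : Set (PointConfig Phase)} (hA : MeasurableSet A) :
    hsLocalSpec σ ν Λ ∅ A =
      (poissonLaw (ν.restrict (window Λ)) (hardCoreSet σ))⁻¹ *
        poissonLaw (ν.restrict (window Λ)) (A ∩ hardCoreSet σ) := by
  have hW : MeasurableSet (window Λ) := HardSphere.measurableSet_window hΛ
  have hae := ae_restrict_eq_self ν h0 hW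
  have hglue : ∀ B : Set (PointConfig Phase),
      (glue Λ (∅ : PointConfig Phase) ⁻¹' B) =ᵐ[poissonLaw (ν.restrict (window Λ))] B := fun B => by
    filter_upwards [hae] with ξ hξ
    refine propext ?_
    change glue Λ ∅ ξ ∈ B ↔ ξ ∈ B
    rw [glue_empty, hξ]
  rw [hsLocalSpec_apply_eq ν σ hΛ ∅ hA, measure_congr (hglue _), measure_congr (hglue _)]

/-- Real form for void events: with `V = {no point in S}`,
`γ_Λ(∅)(V) = Z(∅ ∪ S) / Z(∅)` for the hard-core void functional `Z(F) = P_Λ{hard core, no point in F}` of the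
reference law (written in the shape produced by the tree's decay lemma `abs_ratio_sub_ratio_le_pow`). -/
theorem toReal_hsLocalSpec_empty_setOf_count_eq_zero (ν : Measure Phase) [IsLocallyFiniteMeasure ν]
    (h0 : ∀ x, ν {x} = 0) (σ : ℝ) {Λ : Set Pos} (hΛ : MeasurableSet Λ) {S : Set Phase} (hS : MeasurableSet S) :
    (hsLocalSpec σ ν Λ ∅ {ζ : PointConfig Phase | ζ.count S = 0}).toReal =
      (poissonLaw (ν.restrict (window Λ))).real
          (hardCoreSet σ ∩ {ζ : PointConfig Phase | ζ.count (∅ ∪ S) = 0}) /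
        (poissonLaw (ν.restrict (window Λ))).real
          (hardCoreSet σ ∩ {ζ : PointConfig Phase | ζ.count (∅ : Set Phase) = 0}) := by
  rw [hsLocalSpec_empty_apply_eq_mul ν h0 σ hΛ (measurableSet_count_eq_zero hS), empty_union,
    hardCoreSet_inter_count_empty, inter_comm, ENNReal.toReal_mul, ENNReal.toReal_inv, measureReal_def,
    measureReal_def, div_eq_inv_mul]

/-! ## An abstract perturbation lemma for ratios of integrals -/

/-- **Perturbation of a ratio `∫ a ρ / ∫ a`.** On a measure space let `a, ρ ≥ 0` be measurable, `e ≥ 0`, with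
`ρ ≤ 1`, let `r₀ ≤ 1`, and suppose `ρ ≤ r₀ + e`, `r₀ ≤ ρ + e` pointwise and `∫ a e ≤ C ∫ a` with
`0 < ∫ a < ∞`, `C < ∞`.  Then `|∫ a ρ / ∫ a - r₀| ≤ C` (in `ℝ`). -/
theorem abs_toReal_div_sub_toReal_le {Ω : Type*} [MeasurableSpace Ω] {P : Measure Ω}
    {a ρ e : Ω → ℝ≥0∞} (ha : Measurable a) (hρ : Measurable ρ)
    (hρ1 : ∀ x, ρ x ≤ 1) {r₀ C : ℝ≥0∞} (hr₀ : r₀ ≤ 1) (hC : C ≠ ∞)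
    (hup : ∀ x, ρ x ≤ r₀ + e x) (hlow : ∀ x, r₀ ≤ ρ x + e x)
    (hint : ∫⁻ x, a x * e x ∂P ≤ C * ∫⁻ x, a x ∂P)
    (hpos : ∫⁻ x, a x ∂P ≠ 0) (hfin : ∫⁻ x, a x ∂P ≠ ∞) :
    |((∫⁻ x, a x * ρ x ∂P) / ∫⁻ x, a x ∂P).toReal - r₀.toReal| ≤ C.toReal := by
  set A := ∫⁻ x, a x ∂P with hA
  set B := ∫⁻ x, a x * ρ x ∂P with hB
  have hBA : B ≤ A := by
    rw [hB, hA]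
    calc ∫⁻ x, a x * ρ x ∂P ≤ ∫⁻ x, a x * 1 ∂P := lintegral_mono fun x => mul_le_mul' le_rfl (hρ1 x)
      _ = ∫⁻ x, a x ∂P := by simp
  have hBfin : B ≠ ∞ := ne_top_of_le_ne_top hfin hBA
  -- upper bound `B ≤ (r₀ + C) A`
  have hU : B ≤ (r₀ + C) * A := by
    calc B ≤ ∫⁻ x, a x * (r₀ + e x) ∂P := lintegral_mono fun x => mul_le_mul' le_rfl (hup x)
      _ = ∫⁻ x, r₀ * a x + a x * e x ∂P := lintegral_congr fun x => by ring
      _ = r₀ * A + ∫⁻ x, a x * e x ∂P := by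
          rw [lintegral_add_left (ha.const_mul r₀), lintegral_const_mul r₀ ha]
      _ ≤ r₀ * A + C * A := add_le_add le_rfl hint
      _ = (r₀ + C) * A := by ring
  -- lower bound `r₀ A ≤ B + C A`
  have hL : r₀ * A ≤ B + C * A := by
    calc r₀ * A = ∫⁻ x, r₀ * a x ∂P := (lintegral_const_mul r₀ ha).symm
      _ ≤ ∫⁻ x, a x * (ρ x + e x) ∂P := lintegral_mono fun x => by
          rw [mul_comm]; exact mul_le_mul' le_rfl (hlow x)
      _ = ∫⁻ x, a x * ρ x + a x * e x ∂P := lintegral_congr fun x => by ring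
      _ = B + ∫⁻ x, a x * e x ∂P := by rw [lintegral_add_left (show Measurable fun x => a x * ρ x from ha.mul hρ)]
      _ ≤ B + C * A := add_le_add le_rfl hint
  have hr₀fin : r₀ ≠ ∞ := ne_top_of_le_ne_top ENNReal.one_ne_top hr₀
  -- pass to real numbers
  have hApos : 0 < A.toReal := ENNReal.toReal_pos hpos hfin
  have hq : (B / A).toReal = B.toReal / A.toReal := ENNReal.toReal_div B A
  rw [hq, abs_sub_le_iff]
  constructor
  · -- `B/A - r₀ ≤ C`
    have h1 : B.toReal ≤ (r₀.toReal + C.toReal) * A.toReal := by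
      have := ENNReal.toReal_mono (ENNReal.mul_ne_top (ENNReal.add_ne_top.2 ⟨hr₀fin, hC⟩) hfin) hU
      rwa [ENNReal.toReal_mul, ENNReal.toReal_add hr₀fin hC] at this
    rw [sub_le_iff_le_add, div_le_iff₀ hApos]
    linarith
  · -- `r₀ - B/A ≤ C`
    have h2 : r₀.toReal * A.toReal ≤ B.toReal + C.toReal * A.toReal := by
      have := ENNReal.toReal_mono (ENNReal.add_ne_top.2 ⟨hBfin, ENNReal.mul_ne_top hC hfin⟩) hL
      rwa [ENNReal.toReal_mul, ENNReal.toReal_add hBfin (ENNReal.mul_ne_top hC hfin), ENNReal.toReal_mul] at this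
    rw [sub_le_iff_le_add, add_comm, ← sub_le_iff_le_add, le_div_iff₀ hApos]
    nlinarith

end Summit.AtomisticToContinuum.HydrodynamicLimit.Theorems.MourreKoopmanChargesStressStrongMixing

end
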